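import Summits.NavierStokesRegularity.FluidComputer.PalasekTowerLundgrenChildGaussianHandover
import Literature.Analysis.FluidPDE.PlanarLambOseenPair

/-!
# REGISTER v2.3″ (continued): A NON-GAUSSIAN INHABITANT OF THE CO-SIGNED CLASS — the Lundgren child seeded
# by two co-axial Oseen vortices of different heat ages meets the level-`(k+1)` core clause after
# `13·(33/32)^k` strain units (tuned rates, every level, every schedule; NO planar-run hypothesis left)

Cell `ns-blowup`, seat `ns-blowup-ecbridge-8` (g11); evidence toward crux stmt-NavierStokesRegularity-20305
`HeredityFromTwoT` (standing record 19250), floor `CoreFloorAt k`, MODEL lane «child core = cross-section of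
Lundgren's stretched flow in the host strain `c = λA_k` at `ν = 1`». Sequel of
`PalasekTowerLundgrenChildOseenRun` (the planar Oseen run inhabits the co-signed class of the g9/g10 entropy-clock
theorems — but its Lundgren image is the Burgers vortex with relaxing width, the trivial member). Literature now
also holds a genuinely NON-Gaussian member, `Literature.Analysis.FluidPDE.PlanarLambOseenPair`: the pair
`ṽ(σ) = ṽ_{Γ₁,1}(σ + a₁) + ṽ_{Γ₂,1}(σ + a₂)` of co-axial Oseen vortices (classical planar Navier–Stokes on
`[0, T]`, `ṽ = K₂ ∗ ω̃`, uniformly Schwartz vorticity, hand-over `ω̃(0) = g_{a₁}^{Γ₁} + g_{a₂}^{Γ₂} ≥ 0` of mass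
`Γ₁ + Γ₂`), whose Lundgren image is NOT a Burgers vortex of any width when `a₁ ≠ a₂` and therefore relaxes
under the clock. This file prices its clock:

* §2 `CoreClock.integral_heatGaussian_add_mul_log_div_le` — the hand-over entropy of a two-Gaussian mixture
  relative to the Lundgren Gaussian of its total mass is at most `Γ₁K(a₁/b) + Γ₂K(a₂/b)`,
  `K(r) = r − 1 − log r` (the two-term log-sum inequality `CoreClock.add_mul_log_div_add_le`, i.e. joint
  convexity of the relative entropy, then `CoreClock.integral_heatGaussian_mul_log_div` per vortex);
* §3 `palasekTowerBreakdown_oseenPairRun_child_coreClause_logClock` — any rates `R`, any schedule, any level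
  `k`, any `λ > 0` with `x_k = λN_k^{β−2b} ≥ 1.95`, any `a₁, a₂, Γ₁, Γ₂ > 0`: **`3200·(Γ₁K(a₁λA_k) +
  Γ₂K(a₂λA_k)) ≤ (Γ₁ + Γ₂)e^{λA_k s}` and `Γ₁ + Γ₂ ≥ 0.86·c₁N_{k+1}^{β−2}` ⇒ the level-`(k+1)` core clause
  at strain time `s > 0`** for the pair-seeded child (axial scalar `0`), EVERY planar-run hypothesis of
  `palasekTowerBreakdown_cosigned_child_coreClause_logClock` (`hv`, `hω`, `hBS`, `h0nn`, `hΓ`, `hw`, `hmaps`)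
  discharged;
* §4 `palasekTowerBreakdown_oseenPairRun_child_coreClause_tuned_allLevels` — **`TowerRates.tuned`, EVERY level
  `k`, `λ = 1`, equal circulations `Γ/2` at heat ages `1/(2N_{k+1}²)` (the ledger width) and `1/(8N_{k+1}²)`
  (`a₁A_k = x_k/2`, `a₂A_k = x_k/8`, `H₀ ≤ Γ·5x_k/16`, `x_k = 2^{8.1·(33/32)^k} ≥ 256`): `A_k s ≥ 13·(33/32)^k ∧
  Γ ≥ 0.86·c₁N_{k+1}^{β−2}` ⇒ the level-`(k+1)` core clause** — the same LEVEL-INDEPENDENT `7.7 %` of the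
  window budget `169.85·(33/32)^k` as for the Gaussian hand-over, now for a child that is not a steady Burgers
  vortex.

WHAT THIS IS NOT: not NS about registered flows; no registered `Stage` is constructed; the hand-over is still
radially symmetric and non-negative (the co-signed class requires `ω̃(0) ≥ 0`; sign-changing or non-symmetric
cross-sections are out of scope). The vacuity of the register itself stands and is not used.

## References
* [cite: GallayWayne2005, §1 (the Oseen vortices, display preceding Thm. 1.2); Lemma 3.2 and §3.4]
* [cite: MajdaBertozziCUP2002, §2.2.1 Example 2.2 eqs. (2.15)–(2.16); §1.6 (1.60)–(1.61)]
* [cite: Palasek2026ElementaryModel, §3 (3.2), §3.1]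
-/

noncomputable section

namespace Summit.NavierStokesRegularity.FluidComputer.PalasekTowerClayBridge

open Real Set MeasureTheory Function
open scoped RealInnerProductSpace ContDiff
open Literature.Analysis.FluidPDE Literature.Analysis.FluidPDE.Lundgren Literature.Analysis.Calculus
open CoreLedgerStokes CoreClock

/-! ### §1 Two elementary tools (the window map; the tuned clock number) -/

/-- The Lundgren clock `t ↦ (e^{ct} − 1)/c` (`c > 0`) maps the strain-time window `[0, s]` into the planar
slab `[0, (e^{cs} − 1)/c]`. [folklore] -/
private theorem mapsTo_lundgrenClock_Icc_pair {c s : ℝ} (hc : 0 < c) :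
    MapsTo (fun t => (exp (c * t) - 1) / c) (Icc 0 s) (Icc 0 ((exp (c * s) - 1) / c)) := by
  intro t ht
  refine ⟨div_nonneg ?_ hc.le, div_le_div_of_nonneg_right ?_ hc.le⟩
  · have : 1 ≤ exp (c * t) := one_le_exp (by nlinarith [ht.1])
    linarith
  · have : exp (c * t) ≤ exp (c * s) := exp_le_exp.2 (by nlinarith [ht.2])
    linarith

/-- **The level-uniform clock number**: `1600·2^{8.1t} ≤ e^{13t}` for every `t ≥ 1`
(`1600·2^{8.1} < 439 040 < e^{13}`, then `t`-th powers). [folklore] -/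
private theorem sixteen_hundred_mul_two_rpow_le_exp_pair {t : ℝ} (ht : 1 ≤ t) :
    1600 * (2 : ℝ) ^ ((81 : ℝ) / 10 * t) ≤ exp (13 * t) := by
  have ht0 : 0 ≤ t := zero_le_one.trans ht
  have hxlt : (2 : ℝ) ^ ((81 : ℝ) / 10) < 274.4 := by
    have hp : ((2 : ℝ) ^ ((81 : ℝ) / 10)) ^ (10 : ℕ) = 2 ^ (81 : ℕ) := by
      rw [← Real.rpow_natCast, ← Real.rpow_mul (by norm_num : (0 : ℝ) ≤ 2)]
      norm_num
    refine lt_of_pow_lt_pow_left₀ 10 (by norm_num) ?_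
    rw [hp]; norm_num
  have hexp : (439040 : ℝ) < exp 13 := by
    have he : (2.7182818283 : ℝ) < exp 1 := Real.exp_one_gt_d9
    have hpow : (2.718 : ℝ) ^ 13 < exp 1 ^ 13 := pow_lt_pow_left₀ (by linarith) (by norm_num) (by norm_num)
    have h13' : exp 13 = exp 1 ^ 13 := by rw [← Real.exp_nat_mul]; norm_num
    have hnum : (439040 : ℝ) < (2.718 : ℝ) ^ 13 := by norm_num
    linarith
  have hbase : 1600 * (2 : ℝ) ^ ((81 : ℝ) / 10) ≤ exp 13 := by
    nlinarith [Real.rpow_pos_of_pos two_pos ((81 : ℝ) / 10)]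
  have h2pos : 0 < (2 : ℝ) ^ ((81 : ℝ) / 10) := Real.rpow_pos_of_pos two_pos _
  have h1600 : (1600 : ℝ) ≤ 1600 ^ t := by
    calc (1600 : ℝ) = 1600 ^ (1 : ℝ) := (Real.rpow_one _).symm
      _ ≤ 1600 ^ t := Real.rpow_le_rpow_of_exponent_le (by norm_num) ht
  calc 1600 * (2 : ℝ) ^ ((81 : ℝ) / 10 * t)
      = 1600 * ((2 : ℝ) ^ ((81 : ℝ) / 10)) ^ t := by rw [Real.rpow_mul (by norm_num : (0 : ℝ) ≤ 2)]
    _ ≤ 1600 ^ t * ((2 : ℝ) ^ ((81 : ℝ) / 10)) ^ t :=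
        mul_le_mul_of_nonneg_right h1600 (Real.rpow_nonneg h2pos.le t)
    _ = (1600 * (2 : ℝ) ^ ((81 : ℝ) / 10)) ^ t := by rw [Real.mul_rpow (by norm_num) h2pos.le]
    _ ≤ (exp 13) ^ t := Real.rpow_le_rpow (by positivity) hbase ht0
    _ = exp (13 * t) := by rw [← Real.exp_mul]

/-! ### §2 Two-Gaussian hand-overs: the relative entropy of a mixture (the log-sum inequality) -/

namespace CoreClock

/-- **The two-term log-sum inequality** `(u₁ + u₂)·log((u₁ + u₂)/(v₁ + v₂)) ≤ u₁ log(u₁/v₁) + u₂ log(u₂/v₂)`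
(`uᵢ ≥ 0`, `vᵢ > 0`): Jensen for the convex `x ↦ x log x` (`Real.convexOn_mul_log`) at the points `uᵢ/vᵢ` with
weights `vᵢ/(v₁ + v₂)`. (The same inequality, oppositely oriented, is
`Literature.Analysis.Fourier.mass_mul_log_add_le`; re-derived here to keep the import cone inside the fluid library.)
[folklore] -/
theorem add_mul_log_div_add_le {u₁ u₂ v₁ v₂ : ℝ} (hu₁ : 0 ≤ u₁) (hu₂ : 0 ≤ u₂) (hv₁ : 0 < v₁)
    (hv₂ : 0 < v₂) :
    (u₁ + u₂) * Real.log ((u₁ + u₂) / (v₁ + v₂)) ≤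
      u₁ * Real.log (u₁ / v₁) + u₂ * Real.log (u₂ / v₂) := by
  have hV : 0 < v₁ + v₂ := add_pos hv₁ hv₂
  have h := Real.convexOn_mul_log.2 (Set.mem_Ici.2 (div_nonneg hu₁ hv₁.le))
    (Set.mem_Ici.2 (div_nonneg hu₂ hv₂.le)) (div_nonneg hv₁.le hV.le) (div_nonneg hv₂.le hV.le)
    (by rw [← add_div, div_self hV.ne'])
  simp only [smul_eq_mul] at h
  have e1 : v₁ / (v₁ + v₂) * (u₁ / v₁) + v₂ / (v₁ + v₂) * (u₂ / v₂) = (u₁ + u₂) / (v₁ + v₂) := by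
    field_simp
  have e2 : v₁ / (v₁ + v₂) * (u₁ / v₁ * Real.log (u₁ / v₁)) +
      v₂ / (v₁ + v₂) * (u₂ / v₂ * Real.log (u₂ / v₂)) =
      (u₁ * Real.log (u₁ / v₁) + u₂ * Real.log (u₂ / v₂)) / (v₁ + v₂) := by
    field_simp
  rw [e1, e2, div_mul_eq_mul_div, div_le_div_iff_of_pos_right hV] at h
  exact h

/-- The relative-entropy integrand of two planar heat Gaussians of equal mass is integrable
(`g_a log(g_a/g_b) = (log g_a(0) − log g_b(0))·g_a + (1/(4b) − 1/(4a))·‖η‖²g_a`; mass and second moment).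
[folklore] -/
theorem integrable_heatGaussian_mul_log_div {a b Γ : ℝ} (ha : 0 < a) (hb : 0 < b) (hΓ : 0 < Γ) :
    Integrable (fun η : EuclideanSpace ℝ (Fin 2) => Γ / (4 * π * a) * exp (-(‖η‖ ^ 2 / (4 * a))) *
        Real.log (Γ / (4 * π * a) * exp (-(‖η‖ ^ 2 / (4 * a))) /
          (Γ / (4 * π * b) * exp (-(‖η‖ ^ 2 / (4 * b))))))
      (volume : Measure (EuclideanSpace ℝ (Fin 2))) := by
  have hA : 0 < Γ / (4 * π * a) := by positivity
  have hB : 0 < Γ / (4 * π * b) := by positivity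
  have e : (fun η : EuclideanSpace ℝ (Fin 2) => Γ / (4 * π * a) * exp (-(‖η‖ ^ 2 / (4 * a))) *
      Real.log (Γ / (4 * π * a) * exp (-(‖η‖ ^ 2 / (4 * a))) /
        (Γ / (4 * π * b) * exp (-(‖η‖ ^ 2 / (4 * b)))))) =
      fun η => (Real.log (Γ / (4 * π * a)) - Real.log (Γ / (4 * π * b))) *
          (Γ / (4 * π * a) * exp (-(‖η‖ ^ 2 / (4 * a)))) +
        (1 / (4 * b) - 1 / (4 * a)) * (‖η‖ ^ 2 * (Γ / (4 * π * a) * exp (-(‖η‖ ^ 2 / (4 * a))))) := by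
    funext η
    rw [Real.log_div (mul_pos hA (exp_pos _)).ne' (mul_pos hB (exp_pos _)).ne',
      Real.log_mul hA.ne' (exp_pos _).ne', Real.log_mul hB.ne' (exp_pos _).ne', Real.log_exp, Real.log_exp]
    ring
  rw [e]
  exact ((integrable_heatGaussian ha Γ).const_mul _).add
    ((integrable_norm_sq_mul_heatGaussian ha Γ).const_mul _)

/-- **The hand-over entropy of a two-Gaussian mixture relative to the Gaussian of its total mass**
(`aᵢ, b, Γᵢ > 0`; `gᵢ = Γᵢ/(4πaᵢ)·e^{−‖η‖²/(4aᵢ)}`, reference `g = (Γ₁+Γ₂)/(4πb)·e^{−‖η‖²/(4b)}`):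
`∫ (g₁ + g₂) log((g₁ + g₂)/g) ≤ Γ₁·(a₁/b − 1 − log(a₁/b)) + Γ₂·(a₂/b − 1 − log(a₂/b))` — the log-sum
inequality pointwise with `g = g_b^{Γ₁} + g_b^{Γ₂}` (joint convexity of the relative entropy), then
`integral_heatGaussian_mul_log_div` for each vortex. [folklore] -/
theorem integral_heatGaussian_add_mul_log_div_le {a₁ a₂ b Γ₁ Γ₂ : ℝ} (ha₁ : 0 < a₁) (ha₂ : 0 < a₂)
    (hb : 0 < b) (hΓ₁ : 0 < Γ₁) (hΓ₂ : 0 < Γ₂) :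
    ∫ η : EuclideanSpace ℝ (Fin 2),
        (Γ₁ / (4 * π * a₁) * exp (-(‖η‖ ^ 2 / (4 * a₁))) +
            Γ₂ / (4 * π * a₂) * exp (-(‖η‖ ^ 2 / (4 * a₂)))) *
          Real.log ((Γ₁ / (4 * π * a₁) * exp (-(‖η‖ ^ 2 / (4 * a₁))) +
              Γ₂ / (4 * π * a₂) * exp (-(‖η‖ ^ 2 / (4 * a₂)))) /
            ((Γ₁ + Γ₂) / (4 * π * b) * exp (-(‖η‖ ^ 2 / (4 * b))))) ≤
      Γ₁ * (a₁ / b - 1 - Real.log (a₁ / b)) + Γ₂ * (a₂ / b - 1 - Real.log (a₂ / b)) := by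
  -- the pointwise log-sum inequality, the reference Gaussian split by mass
  have hpt : ∀ η : EuclideanSpace ℝ (Fin 2),
      (Γ₁ / (4 * π * a₁) * exp (-(‖η‖ ^ 2 / (4 * a₁))) +
            Γ₂ / (4 * π * a₂) * exp (-(‖η‖ ^ 2 / (4 * a₂)))) *
          Real.log ((Γ₁ / (4 * π * a₁) * exp (-(‖η‖ ^ 2 / (4 * a₁))) +
              Γ₂ / (4 * π * a₂) * exp (-(‖η‖ ^ 2 / (4 * a₂)))) /
            ((Γ₁ + Γ₂) / (4 * π * b) * exp (-(‖η‖ ^ 2 / (4 * b))))) ≤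
        Γ₁ / (4 * π * a₁) * exp (-(‖η‖ ^ 2 / (4 * a₁))) *
            Real.log (Γ₁ / (4 * π * a₁) * exp (-(‖η‖ ^ 2 / (4 * a₁))) /
              (Γ₁ / (4 * π * b) * exp (-(‖η‖ ^ 2 / (4 * b))))) +
          Γ₂ / (4 * π * a₂) * exp (-(‖η‖ ^ 2 / (4 * a₂))) *
            Real.log (Γ₂ / (4 * π * a₂) * exp (-(‖η‖ ^ 2 / (4 * a₂))) /
              (Γ₂ / (4 * π * b) * exp (-(‖η‖ ^ 2 / (4 * b))))) := by
    intro η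
    have hsplit : (Γ₁ + Γ₂) / (4 * π * b) * exp (-(‖η‖ ^ 2 / (4 * b))) =
        Γ₁ / (4 * π * b) * exp (-(‖η‖ ^ 2 / (4 * b))) +
          Γ₂ / (4 * π * b) * exp (-(‖η‖ ^ 2 / (4 * b))) := by
      ring
    rw [hsplit]
    exact add_mul_log_div_add_le (by positivity) (by positivity) (by positivity) (by positivity)
  have I₁ := integrable_heatGaussian_mul_log_div ha₁ hb hΓ₁
  have I₂ := integrable_heatGaussian_mul_log_div ha₂ hb hΓ₂
  have hK₁ : 0 ≤ a₁ / b - 1 - Real.log (a₁ / b) := by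
    linarith [Real.log_le_sub_one_of_pos (div_pos ha₁ hb)]
  have hK₂ : 0 ≤ a₂ / b - 1 - Real.log (a₂ / b) := by
    linarith [Real.log_le_sub_one_of_pos (div_pos ha₂ hb)]
  by_cases hI : Integrable (fun η : EuclideanSpace ℝ (Fin 2) =>
      (Γ₁ / (4 * π * a₁) * exp (-(‖η‖ ^ 2 / (4 * a₁))) +
            Γ₂ / (4 * π * a₂) * exp (-(‖η‖ ^ 2 / (4 * a₂)))) *
          Real.log ((Γ₁ / (4 * π * a₁) * exp (-(‖η‖ ^ 2 / (4 * a₁))) +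
              Γ₂ / (4 * π * a₂) * exp (-(‖η‖ ^ 2 / (4 * a₂)))) /
            ((Γ₁ + Γ₂) / (4 * π * b) * exp (-(‖η‖ ^ 2 / (4 * b))))))
      (volume : Measure (EuclideanSpace ℝ (Fin 2)))
  · calc _ ≤ ∫ η : EuclideanSpace ℝ (Fin 2),
          Γ₁ / (4 * π * a₁) * exp (-(‖η‖ ^ 2 / (4 * a₁))) *
              Real.log (Γ₁ / (4 * π * a₁) * exp (-(‖η‖ ^ 2 / (4 * a₁))) /
                (Γ₁ / (4 * π * b) * exp (-(‖η‖ ^ 2 / (4 * b))))) +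
            Γ₂ / (4 * π * a₂) * exp (-(‖η‖ ^ 2 / (4 * a₂))) *
              Real.log (Γ₂ / (4 * π * a₂) * exp (-(‖η‖ ^ 2 / (4 * a₂))) /
                (Γ₂ / (4 * π * b) * exp (-(‖η‖ ^ 2 / (4 * b))))) := integral_mono hI (I₁.add I₂) hpt
      _ = Γ₁ * (a₁ / b - 1 - Real.log (a₁ / b)) + Γ₂ * (a₂ / b - 1 - Real.log (a₂ / b)) := by
          rw [integral_add I₁ I₂, integral_heatGaussian_mul_log_div ha₁ hb hΓ₁,
            integral_heatGaussian_mul_log_div ha₂ hb hΓ₂]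
  · rw [integral_undef hI]
    positivity

end CoreClock

/-! ### §3 The pair-seeded child: the log clock with every planar-run hypothesis discharged -/

/-- **THE CO-SIGNED CORE CLOCK FOR A NON-GAUSSIAN HAND-OVER — TWO CO-AXIAL OSEEN VORTICES** (any rates `R`,
any schedule, any level `k`, any `λ > 0` with `x_k = λN_k^{β−2b} ≥ 1.95`, any heat ages `a₁, a₂ > 0` and
circulations `Γ₁, Γ₂ > 0`): the Lundgren child whose planar run is the pair
`σ ↦ ṽ_{Γ₁,1}(σ + a₁) + ṽ_{Γ₂,1}(σ + a₂)` of `Literature.Analysis.FluidPDE.PlanarLambOseenPair` (classical planar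
Navier–Stokes on `[0, (e^{λA_k s} − 1)/(λA_k)]`, `ṽ = K₂ ∗ ω̃`, uniformly Schwartz vorticity, hand-over
`ω̃(0) = (Γ₁/4πa₁)e^{−|η|²/4a₁} + (Γ₂/4πa₂)e^{−|η|²/4a₂} ≥ 0` of mass `Γ₁ + Γ₂` — ALL DISCHARGED) and whose
axial scalar is `0` satisfies: **if `3200·(Γ₁K(a₁λA_k) + Γ₂K(a₂λA_k)) ≤ (Γ₁ + Γ₂)·e^{λA_k s}`
(`K(r) = r − 1 − log r`, the log-sum bound `H₀ ≤ Γ₁K(a₁c) + Γ₂K(a₂c)` of §2 on the hand-over entropy) and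
`Γ₁ + Γ₂ ≥ 0.86·c₁N_{k+1}^{β−2}` then the level-`(k+1)` core clause holds at strain time `s > 0`** on every
cross-section `{x₂ = z₀}`, `|z₀| ≤ radius` (`palasekTowerBreakdown_cosigned_child_coreClause_logClock` with its
planar run instantiated). When `a₁ ≠ a₂` the hand-over is not a Gaussian, so the child is NOT a steady Burgers
vortex and genuinely relaxes under the clock. MODEL statement; not about any registered flow.
[cite: GallayWayne2005, §1 (the Oseen vortices, display preceding Thm. 1.2), Lemma 3.2 and §3.4; Palasek2026ElementaryModel, §3.1] -/
theorem palasekTowerBreakdown_oseenPairRun_child_coreClause_logClock (R : TowerRates) (Sch : Schedule R)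
    (k : ℕ) {l : ℝ} (hl : 0 < l) {a₁ a₂ Γ₁ Γ₂ : ℝ} (ha₁ : 0 < a₁) (ha₂ : 0 < a₂) (hΓ₁ : 0 < Γ₁)
    (hΓ₂ : 0 < Γ₂) {s : ℝ} (hs : 0 < s) {z₀ : ℝ} (hz₀ : |z₀| ≤ Sch.radius)
    (hx : 1.95 ≤ l * R.N k ^ (R.β - 2 * R.b))
    (hclock : 3200 * (Γ₁ * (a₁ * (l * R.A k) - 1 - Real.log (a₁ * (l * R.A k))) +
        Γ₂ * (a₂ * (l * R.A k) - 1 - Real.log (a₂ * (l * R.A k)))) ≤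
      (Γ₁ + Γ₂) * exp (l * R.A k * s))
    (hC : 0.86 * Sch.c₁ * R.N (k + 1) ^ (R.β - 2) ≤ Γ₁ + Γ₂) :
    ∃ (x' : EuclideanSpace ℝ (Fin 3)) (γ : ℝ → EuclideanSpace ℝ (Fin 3)),
      ‖x'‖ ≤ Sch.radius ∧ ContDiff ℝ 1 γ ∧ γ 0 = γ 1 ∧
      (∀ σ ∈ Icc (0 : ℝ) 1, γ σ ∈ Metric.closedBall x' (1 / R.N (k + 1))) ∧
      (∀ σ ∈ Icc (0 : ℝ) 1, ‖deriv γ σ‖ ≤ 8 * π / R.N (k + 1)) ∧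
      Sch.c₁ * R.N (k + 1) ^ (R.β - 2) ≤
        circulation (velocity (fun _ => l * R.A k)
          (fun t y => exp (l * R.A k * t / 2) •
            PlanarLambOseen.pairVelocity Γ₁ a₁ Γ₂ a₂ 1 ((exp (l * R.A k * t) - 1) / (l * R.A k))
              (exp (l * R.A k * t / 2) • y))
          (fun t y => exp (-(l * R.A k * t)) •
            (fun (_ : ℝ) (_ : EuclideanSpace ℝ (Fin 2)) => (0 : ℝ))
              ((exp (l * R.A k * t) - 1) / (l * R.A k)) (exp (l * R.A k * t / 2) • y)) s) γ := by
  set c : ℝ := l * R.A k with hc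
  have hcpos : 0 < c := mul_pos hl (R.A_pos k)
  set T : ℝ := (exp (c * s) - 1) / c with hT
  have hTpos : 0 < T := by
    rw [hT]
    refine div_pos ?_ hcpos
    have : 1 < exp (c * s) := Real.one_lt_exp_iff.2 (mul_pos hcpos hs)
    linarith
  have hmaps : MapsTo (fun t => (exp (c * t) - 1) / c) (Icc 0 s) (Icc 0 T) :=
    mapsTo_lundgrenClock_Icc_pair hcpos
  have hv := PlanarLambOseen.isClassicalNSSolutionOn_pair_Icc (a₁ := a₁) (a₂ := a₂) Γ₁ Γ₂ one_pos ha₁ ha₂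
    hTpos
  have hω := PlanarLambOseen.hasUniformRapidDecayOn_planarVorticity_pair (α₁ := Γ₁) (α₂ := Γ₂) one_pos
    ha₁ ha₂ hTpos
  have hBS := PlanarLambOseen.pairVelocity_eq_biotSavart2D_Icc (α₁ := Γ₁) (α₂ := Γ₂) one_pos ha₁ ha₂ T
  have hinit : ∀ η : EuclideanSpace ℝ (Fin 2),
      PlanarEigenmode.vorticity (PlanarLambOseen.pairVelocity Γ₁ a₁ Γ₂ a₂ 1 0) η =
        Γ₁ / (4 * π * a₁) * exp (-(‖η‖ ^ 2 / (4 * a₁))) +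
          Γ₂ / (4 * π * a₂) * exp (-(‖η‖ ^ 2 / (4 * a₂))) := by
    intro η
    rw [PlanarLambOseen.planarVorticity_pairVelocity_zero one_ne_zero η]
    congr 1
    · congr 1
      · ring
      · congr 1; ring
    · congr 1
      · ring
      · congr 1; ring
  have hint : ∫ y, PlanarEigenmode.vorticity (PlanarLambOseen.pairVelocity Γ₁ a₁ Γ₂ a₂ 1 0) y = Γ₁ + Γ₂ :=
    PlanarLambOseen.integral_planarVorticity_pairVelocity_zero one_pos ha₁ ha₂
  have h0nn : ∀ η, 0 ≤ PlanarEigenmode.vorticity (PlanarLambOseen.pairVelocity Γ₁ a₁ Γ₂ a₂ 1 0) η :=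
    fun η => PlanarLambOseen.planarVorticity_pairVelocity_zero_nonneg hΓ₁.le hΓ₂.le one_pos ha₁ ha₂ η
  have hΓ' : 0 < ∫ y, PlanarEigenmode.vorticity (PlanarLambOseen.pairVelocity Γ₁ a₁ Γ₂ a₂ 1 0) y := by
    rw [hint]; exact add_pos hΓ₁ hΓ₂
  have hw : IsSmoothSpaceTimeOn (Icc 0 T) (fun (_ : ℝ) (_ : EuclideanSpace ℝ (Fin 2)) => (0 : ℝ)) :=
    contDiffOn_const
  have hH₀ := integral_heatGaussian_add_mul_log_div_le ha₁ ha₂ (inv_pos.2 hcpos) hΓ₁ hΓ₂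
  rw [div_inv_eq_mul, div_inv_eq_mul] at hH₀
  refine palasekTowerBreakdown_cosigned_child_coreClause_logClock R Sch k hl (convex_Icc 0 T) hv hω hBS h0nn hΓ'
    hw hmaps (left_mem_Icc.2 hTpos.le) (right_mem_Icc.2 hs.le) hs.le hz₀ hx ?_ ?_
  · rw [hint]
    simp only [hinit]
    linarith [mul_le_mul_of_nonneg_left hH₀ (by norm_num : (0 : ℝ) ≤ 3200)]
  · rw [hint]; exact hC

/-! ### §4 The tuned rates, every level: the same thirteen level-`k` strain units for the pair -/

/-- **EVERY LEVEL OF THE TUNED RATES, NON-GAUSSIAN HAND-OVER** (`TowerRates.tuned`, any level `k`, `λ = 1`, EVERY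
schedule): the Lundgren child seeded by the pair of co-axial Oseen vortices of equal circulations `Γ/2` and heat
ages `1/(2N_{k+1}²)` (the ledger width) and `1/(8N_{k+1}²)` (half the ledger width) — so `a₁A_k = x_k/2`,
`a₂A_k = x_k/8` and, by §2, `H₀ ≤ (Γ/2)(x_k/2) + (Γ/2)(x_k/8) = Γ·5x_k/16` (`K(r) ≤ r` for `2r ≥ 1.95`,
`x_k = 2^{8.1·(33/32)^k} ≥ 256`) — **meets the level-`(k+1)` core clause at every strain time `s` with
`A_k s ≥ 13·(33/32)^k`, provided `Γ ≥ 0.86·c₁N_{k+1}^{β−2}`** (`1600·2^{8.1t} ≤ e^{13t}`, `t = b^k ≥ 1`), every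
planar-run hypothesis discharged by `Literature.Analysis.FluidPDE.PlanarLambOseenPair`: the same LEVEL-INDEPENDENT
`7.7 %` of the window budget `169.85·(33/32)^k` as the Gaussian hand-over, for a child that is not a steady Burgers
vortex. MODEL statement; not about any registered flow; no `Stage` constructed.
[cite: GallayWayne2005, §1 (the Oseen vortices, display preceding Thm. 1.2), Lemma 3.2 and §3.4; Palasek2026ElementaryModel, §3 (3.2), §3.1] -/
theorem palasekTowerBreakdown_oseenPairRun_child_coreClause_tuned_allLevels (Sch : Schedule TowerRates.tuned)
    (k : ℕ) {Γ : ℝ} (hΓ : 0 < Γ) {s : ℝ} (hs13 : 13 * (33 / 32 : ℝ) ^ k ≤ TowerRates.tuned.A k * s)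
    {z₀ : ℝ} (hz₀ : |z₀| ≤ Sch.radius)
    (hC : 0.86 * Sch.c₁ * TowerRates.tuned.N (k + 1) ^ (TowerRates.tuned.β - 2) ≤ Γ) :
    ∃ (x' : EuclideanSpace ℝ (Fin 3)) (γ : ℝ → EuclideanSpace ℝ (Fin 3)),
      ‖x'‖ ≤ Sch.radius ∧ ContDiff ℝ 1 γ ∧ γ 0 = γ 1 ∧
      (∀ σ ∈ Icc (0 : ℝ) 1, γ σ ∈ Metric.closedBall x' (1 / TowerRates.tuned.N (k + 1))) ∧
      (∀ σ ∈ Icc (0 : ℝ) 1, ‖deriv γ σ‖ ≤ 8 * π / TowerRates.tuned.N (k + 1)) ∧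
      Sch.c₁ * TowerRates.tuned.N (k + 1) ^ (TowerRates.tuned.β - 2) ≤
        circulation (velocity (fun _ => 1 * TowerRates.tuned.A k)
          (fun t y => exp (1 * TowerRates.tuned.A k * t / 2) •
            PlanarLambOseen.pairVelocity (Γ / 2) (1 / (2 * TowerRates.tuned.N (k + 1) ^ 2)) (Γ / 2)
              (1 / (8 * TowerRates.tuned.N (k + 1) ^ 2)) 1
              ((exp (1 * TowerRates.tuned.A k * t) - 1) / (1 * TowerRates.tuned.A k))
              (exp (1 * TowerRates.tuned.A k * t / 2) • y))
          (fun t y => exp (-(1 * TowerRates.tuned.A k * t)) •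
            (fun (_ : ℝ) (_ : EuclideanSpace ℝ (Fin 2)) => (0 : ℝ))
              ((exp (1 * TowerRates.tuned.A k * t) - 1) / (1 * TowerRates.tuned.A k))
              (exp (1 * TowerRates.tuned.A k * t / 2) • y)) s) γ := by
  have hA := TowerRates.tuned.A_pos k
  have hN1 := TowerRates.tuned.N_pos (k + 1)
  have hbk : (1 : ℝ) ≤ (33 / 32 : ℝ) ^ k := one_le_pow₀ (by norm_num)
  have hs : 0 < s := by nlinarith
  have ha₁ : 0 < 1 / (2 * TowerRates.tuned.N (k + 1) ^ 2) := by positivity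
  have ha₂ : 0 < 1 / (8 * TowerRates.tuned.N (k + 1) ^ 2) := by positivity
  -- `x_k = 2^{8.1·(33/32)^k} ≥ 256`
  set x : ℝ := 1 * TowerRates.tuned.N k ^ (TowerRates.tuned.β - 2 * TowerRates.tuned.b) with hxdef
  have hxeq : x = (2 : ℝ) ^ ((81 : ℝ) / 10 * (33 / 32 : ℝ) ^ k) := by
    rw [hxdef, one_mul, TowerRates.tuned_N_eq_two_rpow, ← Real.rpow_mul (by norm_num : (0 : ℝ) ≤ 2)]
    simp only [TowerRates.tuned]
    ring_nf
  have hx256 : 256 ≤ x := by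
    rw [hxdef, one_mul]; exact TowerRates.tuned_coreRatio_ge k
  have hx : 1.95 ≤ x := by linarith
  -- `a₁A_k = x/2`, `a₂A_k = x/8`, `K(r) ≤ r`
  have hr₁ : 1 / (2 * TowerRates.tuned.N (k + 1) ^ 2) * (1 * TowerRates.tuned.A k) = x / 2 := by
    rw [hxdef, ← palasekTowerBreakdown_coreRatio_eq]
    field_simp
  have hr₂ : 1 / (8 * TowerRates.tuned.N (k + 1) ^ 2) * (1 * TowerRates.tuned.A k) = x / 8 := by
    rw [hxdef, ← palasekTowerBreakdown_coreRatio_eq]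
    field_simp
  have hK₁ := CoreClock.sub_one_sub_log_le_self (r := x / 2) (by linarith)
  have hK₂ := CoreClock.sub_one_sub_log_le_self (r := x / 8) (by linarith)
  -- the clock: `1600·x_k ≤ e^{13 b^k} ≤ e^{A_k s}`
  have hclock0 : 1600 * x ≤ exp (1 * TowerRates.tuned.A k * s) := by
    rw [hxeq]
    refine (sixteen_hundred_mul_two_rpow_le_exp_pair hbk).trans (exp_le_exp.2 ?_)
    linarith
  refine palasekTowerBreakdown_oseenPairRun_child_coreClause_logClock TowerRates.tuned Sch k one_pos ha₁ ha₂
    (half_pos hΓ) (half_pos hΓ) hs hz₀ hx ?_ ?_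
  · rw [hr₁, hr₂]
    have h1 : Γ / 2 * (x / 2 - 1 - Real.log (x / 2)) ≤ Γ / 2 * (x / 2) :=
      mul_le_mul_of_nonneg_left hK₁ (by positivity)
    have h2 : Γ / 2 * (x / 8 - 1 - Real.log (x / 8)) ≤ Γ / 2 * (x / 8) :=
      mul_le_mul_of_nonneg_left hK₂ (by positivity)
    have h3 := mul_le_mul_of_nonneg_left hclock0 hΓ.le
    have h4 : 0 ≤ Γ * x := mul_nonneg hΓ.le (by linarith)
    nlinarith
  · rw [add_halves]; exact hC

end Summit.NavierStokesRegularity.FluidComputer.PalasekTowerClayBridge
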